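import Mathlib
import HarnessLib
import HarnessLib.Audit
import Summits.BirchSwinnertonDyer.Statement
import Summits.BirchSwinnertonDyer.BirchSwinnertonDyer.Theorems.PrintX9HowardRankOne
import Literature.NumberTheory.EllipticCurves.CastellaGrossiLeeSkinner2022.HowardDivisibilityAnyClassNumber
import Summits.BirchSwinnertonDyer.BirchSwinnertonDyer.Theorems.SignedLowerHalvesRealPeriodUnitPlusPeriod
import Summits.BirchSwinnertonDyer.BirchSwinnertonDyer.Theorems.ManinLocalTwoThreeMazurManinConstantOddPrimes
import Summits.BirchSwinnertonDyer.BirchSwinnertonDyer.Theorems.InputsGreenbergCharValueRankZeroByName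
import Summits.BirchSwinnertonDyer.BirchSwinnertonDyer.Theorems.PrintX9AnticyclotomicTowerInRingClassFields
import Summits.BirchSwinnertonDyer.BirchSwinnertonDyer.Theorems.Rank1ResidualX9Defs
import HarnessLib.Audit.Status.Attr

/-!
Route: TorsionLayerDescent

CLOSED (superseded) 2026-08-28T08:46:55Z by planner-bsd-idea-2-g5-0 — reason: superseded:route-BirchSwinnertonDyer-PrintX9 — superseded by route-BirchSwinnertonDyer-PrintX9 — note: pen bsd-idea-2 g5, director-bsd RULING (beta) 07:53:33Z: TLD's tied cruxes 25546 HowardContainmentAnyClassNumberOfPrint / 25547 TwoSidedLinkAnyClassNumberOfPrint are superseded by the PINNED tied items of PrintX9 rev 26 (26359 HowardContainmentLightFramePinnedOfPrint / 26360 TwoSidedLinkPinnedOfPrin. The file is kept as the record of this route; refuted decls are indexed as negative knowledge (`ledger negatives`).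

# Route TorsionLayerDescent — X9 Howard road for every class number — descent through the p-torsion
layer of the ring-class tower dissolves the frame-supply residual (K6 leaf BSDpOnClassX9)

LINE (D-0145 ideator bsd-idea-2 g0; bears_on rung K6 / the X9 Heegner road of cell bsd-print-x9 —
leaf `Rank1Residual.BSDpOnClassX9`, whose landed print reduction
`bsdpOnClassX9_of_heegnerFrameSupply_of_cor46_of_integralMainConjectureOnClassX9` carries the
class-wide FRAME-SUPPLY binder hFS = «∃ Heegner K with p split, d_K odd < −4, L(E^(d_K),1) ≠ 0 AND p
∤ h_K»; no summit is proved by this line). It suffices to show X = A ∧ B: (A) Howard's containment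
Char(S/Λκ)² ⊆ Char(X_tors) and (B) the two-sided IMC∘BDP link in the JSW letter hold at every
rank-one X9 Heegner datum WITHOUT the hypothesis p ∤ h_K. Then hFS loses its class-number conjunct
and becomes Friedberg–Hoffstein 1995 Thm. B (print), and the leaf follows from the K6 rank-0 engine
`IntegralMainConjectureOnClassX9` by the cell's landed assembly with one binder deleted.
Lean:
`Summit.BirchSwinnertonDyer.BirchSwinnertonDyer.Theses.TorsionLayerDescent.HowardContainmentAnyClassNumber
∧
Summit.BirchSwinnertonDyer.BirchSwinnertonDyer.Theses.TorsionLayerDescent.TwoSidedLinkAnyClassNumber`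

## Assembly
`Assembly` is the composition (kernel glue, size S); the deciding theorem `closes (hAsm : Assembly)
(hA) (hB) (hF) (hE) (hD) : BSDpOnClassX9 := hAsm hA hB hF hE hD` is certified (glue.lean). Recipe
for `Assembly`: copy `X9.indexIdentityAt_of_heegner_of_cor46_of_thm331`
(Theorems/PrintX9HowardIMCLink.lean §3) replacing the calls `X9.heegnerContainment_of_cor46 h46 …
hhK` and `X11b.imcWaldspurgerOnTreeGoodAt_inducedPlace_of_heegnerContainment_of_thm331 hYZ h331 …
hhK …` by cruxes A and B (binder `hhK` deleted), then
`X9.bsdp_rankOne_of_howardFrame_of_x9IntegralMainConjecture` and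
`bsdpOnClassX9_of_heegnerFrameSupply_of_cor46_of_integralMainConjectureOnClassX9`
(Theorems/PrintX9HowardRankOne.lean ll. 96–216) verbatim without `hhK`; the rank-0 branch is
`EngineIMCX9` + `greenberg_charValue_rankZero` as there.

CLOSES_TARGET: closes rung K6 of BirchSwinnertonDyer: Summit.BirchSwinnertonDyer.BirchSwinnertonDyer.Rank1Residual.BSDpOnClassX9 (D-0061; not the summit Statement) — the deciding theorem of this route concludes that registered leaf instead of the Statement decl `BirchSwinnertonDyer` (class rung: servable and labelled, never counted as concluding the summit Statement).

Rationale: WHY THIS LINE. The X9 Howard road (Mastella–Zerman 2026 Cor. 4.6 at scalar image, arXiv:2505.08710,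
+ the Yan–Zhu/BCS/CGLS two-sided composite, arXiv:2412.20078 / arXiv:2405.00270 /
CastellaGrossiLeeSkinner2022, + JSW 2017 Thm. 3.3.1 control) is landed in the tree modulo named
facts EXCEPT for the frame supply: every printed input is stated under Howard's standing hypothesis
p ∤ h_K (MZ26 Assumption 2.1; the tree's `Thm57Hypotheses.not_dvd_classNumber`, flagged EXTRA), so
the class-wide residual is the JOINT supply «p ∤ h_K ∧ L(E^(d_K),1) ≠ 0», for which no mechanism
exists (class numbers and twisted central values run through two different weight-3/2 forms,
Kohnen–Ono 1999 doi:10.1007/s002220050290 Thm. 1 vs Cor. 7; it is the open crux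
`HeegnerTwistCouplingInSupply` stmt-BirchSwinnertonDyer-21381 of the CM route). This line removes
the conjunct at the source instead of supplying it: when p | h_K the anticyclotomic tower K_∞ meets
the Hilbert class field in the p-torsion layer Δ_p of Gal(K[p^∞]/K), and Castella–Grossi–Lee–Skinner
(arXiv:2008.02571, Thm. 4.1 and its proof: P_k[n] := Norm over K[np^d(k)]/K_k[n], «the arguments
apply almost verbatim when p divides the class number») already build the Heegner Kolyvagin system
through that layer; Yan–Zhu Thm. 5.7 (2) is rational and class-number-free in print; the only
integral residue is the explicit factor h_K in Greenberg's two-variable p-adic L-function (Yan–Zhu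
Def. 3.10, 𝓛^Gr = h_K·𝓛_𝔭(K)′·𝓛^II), which is booked against μ: μ(BDP) = 0 (Hsieh 2014
doi:10.4171/dm/466, Burungale 2017) and Rubin's two-variable main conjecture for K (Rubin1991)
control the p-power exactly — the monotone/controlling quantity of this seat's technique card is the
μ-invariant along the torsion layer. Imported from: anticyclotomic Iwasawa theory (Kolyvagin systems
over ring-class towers), CM Iwasawa theory of K (class-group μ), nothing from outside number theory.

RANKED CRUXES. #2 HowardContainmentAnyClassNumber (crux) — for every X9 pair (E,p) (p ≥ 5 good
ordinary, E[p] irreducible with non-surjective image, non-CM), every imaginary quadratic K with d_K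
∉ {−3,−4} satisfying the Heegner hypothesis for N_E and for p (p split), every anticyclotomic
ℤ_p-extension datum (κ, γ) and every modular parametrisation / Heegner datum, there exist the Λ-adic
Selmer data, a Heegner family (in the tree's sense) and a Selmer dual with heegnerCharIdeal² ≤
char(X_tors) — Howard's Theorem B containment — with NO hypothesis on the class number of K (the
landed `X9.heegnerContainment_of_cor46` is exactly this with `¬ p ∣ classNumber K` added, from
Mastella–Zerman Cor. 4.6). [difficulty: L] (why it might fail: when K_∞ ∩ H_K ≠ K the tree's
norm-point Heegner family generates a proper submodule of the CGLS enlarged module ∪_k H_k[1], so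
heegnerCharIdeal D F may exceed char(Sel/Λκ₁) by a factor at (p, γ−1) and the containment as typed
can fail by it; MZ26 §3 uses p ∤ h_K for K[n] ∩ K_∞ = K.) [arXiv:2505.08710, arXiv:2008.02571,
arXiv:1908.09512, Howard2004HeegnerKolyvagin, LombardoTronto2022]
#3 TwoSidedLinkAnyClassNumber (crux) — at every rank-one X9 Heegner datum (E, p, K, ι, κ
anticyclotomic, γ, Dt with p ∤ c(Dt), H, P = the Heegner point, rank E(K) = 1, Ш(E/K)[p^∞] finite, P
non-torsion, (irr_K)) over a Heegner field with p split, d_K odd ≠ −3, GRANTED Howard's containment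
(the ∃-statement of crux A), the two-sided IMC∘BDP identity in the JSW/Castella letter
`X11b.IMCWaldspurgerOnTreeGoodAt p κ (inducedPlace ι) γ ι P` holds — with NO hypothesis on h_K (the
landed `X11b.imcWaldspurgerOnTreeGoodAt_inducedPlace_of_heegnerContainment_of_thm331` is this with
`¬ p ∣ classNumber K`, from Yan–Zhu 5.7(1)+5.9, BCS Prop. 4.2.2, CGLS Thm. 5.1.3, JSW Thm. 3.3.1).
[deps: HowardContainmentAnyClassNumber] [difficulty: L] (why it might fail: the integral comparison
runs through Greenberg's L, 𝓛^Gr = h_K·𝓛_𝔭(K)′·𝓛^II (Yan–Zhu Def. 3.10): for p | h_K it is off by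
p^v_p(h_K) unless the class-group μ matches integrally, and at (irr) the Beilinson–Flach reciprocity
(CGS Lemma 3.11) is only integral, not a unit.) [arXiv:2412.20078, arXiv:2405.00270,
CastellaGrossiLeeSkinner2022, JetchevSkinnerWan2017, doi:10.4171/dm/466, Rubin1991]
#9 LightFrameSupplyOdd (support) — PRINT (Friedberg–Hoffstein 1995 Thm. B with prescribed local
behaviour at 2, p, ∞ and the primes of N_E; cf. JSW 2017 §7.4.1): every X9 pair of analytic rank one
has an imaginary quadratic K with d_K odd < −4, Heegner for N_E, p split, and L(E^(d_K),1) ≠ 0 — the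
cell's hFS with the class-number conjunct DELETED. The tree fact
`friedbergHoffstein_exists_heegnerField_split_twist_ne_zero` gives everything except `Odd d_K`
(automatic when 2 | N_E; else one more local condition at 2 in FH). [difficulty: M]
[FriedbergHoffstein1995, JetchevSkinnerWan2017, BumpFriedbergHoffstein1990]
#9 EngineIMCX9 (support) — BY NAME — the K6 rank-0 engine on class X9,
`Rank1Residual.IntegralMainConjectureOnClassX9` (the cell's landed
`integralMainConjectureOnClassX9_of_katoMuTransfer` reduces it to BCS Thm 1.1.1(im-free) +
KatoMuTransfer + AnalyticMuZeroOnClassX9, i.e. to route SmallImageMuTransfer's cruxes); this line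
does not touch it. [difficulty: open-problem] [arXiv:2405.00270, Kato2004Asterisque, Greenberg1999]
#9 DescentPrintFacts (support) — the conjunction of the PUBLISHED named facts consumed by the
per-pair descent and the index identity: JSW 2017 Thm. 3.3.1 (anticyclotomic control), Gross–Zagier,
Kolyvagin, Greenberg's rank-0 characteristic value, GZK rank = analytic rank ≤ 1, entire L-function
over ℚ, existence of modular parametrisations and of the attached newform, Mazur's Manin-constant
theorem (odd part), integral Néron scaling at a minimal model, real period = unit · plus-period.
[difficulty: provable-now] [JetchevSkinnerWan2017, GrossZagier1986, Kolyvagin1990, Greenberg1999,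
Mazur1978]

TWO-LAYER PLAN. HowardContainmentAnyClassNumber ⇐ (A1) the CGLS enlarged Heegner module ℋ[1] = ∪_k
H_k[1] ⊂ S(K_∞) has the same Λ-characteristic ideal of S/ℋ[1] as S/ΛF for the tree's family F up to
a unit when K_∞ ∩ H_K = K_k₀ (index p^k₀) — the torsion-layer comparison; (A2) Mastella–Zerman §3–§4
(scalar-image Kolyvagin bound) run for ℋ[1] with K[n] ∩ K_∞ = K_k₀. TwoSidedLinkAnyClassNumber ⇐
(B1) Yan–Zhu 5.7 (2) rational equality at any h_K (print) + (B2) integrality of the h_K-factor via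
μ(BDP) = 0 (Hsieh) and Rubin's two-variable MC for K. Foreseen glued splits only; not filed until a
crux closes.

KILL CRITERIA. A rank-one X9 pair (E,p) and a Heegner field K with p | h_K, p split, at which a
certified computation (Heegner index [E(K):ℤP_K], #Ш(E/K)[p^∞] via p-descent / Cassels–Tate,
Tamagawa numbers) violates the Gross–Zagier-shape identity 2·v_p(∏c_ℓ) + v_p #Ш(E/K) =
2·v_p[E(K):ℤP_K] would refute A ∧ B (the identity is their landed consequence); a Λ-adic
counterexample to Howard's containment with p | h_K in the CGLS setting refutes A directly. Either
refutation closes the route.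

NOT DECOMPOSED YET. The torsion-layer comparison (A1) needs the tree's `HeegnerFamily` API to expose
the bottom norm-compatible point over K_k₀ = K_∞ ∩ H_K; the h_K-bookkeeping (B2) needs Greenberg's
two-variable L (Yan–Zhu Def. 3.10) typed — both layer-2, filed only after a grounder confirms the
crux signatures.

CHEAPEST FALSIFIER. Literature check (one refuter-hour): read CGLS arXiv:2008.02571 §4 (proof of
Thm. 4.1, Lemma 2.3.4 «almost verbatim when p | h_K») and Mastella–Zerman arXiv:2505.08710 §3 to see
whether Assumption 2.1's p ∤ h_K is used anywhere except through Howard's K[n] ∩ K_∞ = K; and the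
instrument row CNF-FRAME-TABLE: for the 6/135 rank-one X9 census pairs all of whose on-disk Heegner
frames have p | h_K (cell bsd-print-x9 DOSSIER §36), list (E, p, K, v_p(h_K), [E(K):ℤP_K],
#Ш(E/K)[p] from 2- /p-descent) and test the index identity numerically (Magma/PARI HeegnerPoint + Sha
bounds) — one violating row kills the line.

NUMBERS. X9 census (cell bsd-print-x9): 790 pairs, 135 of analytic rank one; DOSSIER §36: for
129/135 a frame with p ∤ h_K exists on disk (|d_K| ≤ 2000), 6/135 have only frames with p | h_K in
that range; h_K < p is automatic for |d_K| < p² /… (genus/Minkowski), so small-|d_K| frames never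
test the crux. CM λ-table v1 (kit job j291624, 149 rows) is for LINE 1, not this line.

DEFINITION REQUESTS. None: all items typed over existing declarations (`HeegnerFamily`,
`heegnerCharIdeal`, `LambdaAdicSelmerData`, `SelmerDualData`, `X11b.IMCWaldspurgerOnTreeGoodAt`,
`X11b.inducedPlace`, `Rank1Residual.ClassX9`).

Novelty: Searches (2026-08-27): `lit read arXiv:2505.08710 --grep "class number"`
[corpus:paper:arxiv-2505.08710 p.3 L11, p.6 L16: assumed p ∤ h_K]; `lit read arXiv:2008.02571 --grep
"class number"` [corpus:paper:arxiv-2008.02571 p.22: Thm 4.1 «Under the additional hypotheses that p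
∤ h_K … this is [howard] … we explain how to adapt», Lemma 2.3.4 «almost verbatim when p divides the
class number»]; `lit read arXiv:2412.20078 --grep "h_K"` [corpus:paper:arxiv-2412.20078 p.9 Def
3.10: 𝓛^Gr := h_K·𝓛_𝔭(K)′·𝓛^II]; `lit read arXiv:1908.09512 --grep "class num"` (BCK21 Thm 3.1
(Howard) printed WITHOUT a class-number hypothesis: p > 3 good ordinary, (D_K, pN) = 1, ρ̄|G_K abs.
irreducible) [corpus:paper:arxiv-1908.09512 p.7]; `lit read arXiv:2405.00270 --grep "class number"`
(no hit); `lit search --hybrid "Heegner point Kolyvagin system p divides class number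
anticyclotomic"`; galaxy `"class number|Heegner point main conjecture"` --star pdf (no treatment of
p | h_K beyond CGLS); tree: `rg classNumber lean/Summits/BirchSwinnertonDyer/**/Theses` (every
Heegner-road route carries `¬ p ∣ classNumber K`: PrintX9HowardRankOne, BiquadraticEisensteinDescent
stmt-21381/HeegnerClassNumberSupplyCMInertBadOfBRR, X11b BDPRoute); `ledger negatives --problem
BirchSwinnertonDyer` (no statement about class numbers of Heegner fields).
Nearest prior art found: arXiv:2008.02571 Thm. 4.1 (CGLS: Howard's Kolyvagin-system theorem for any
h_K at big image, p-converse setting); arXiv:1908.09512 Thm. 3.1 (statement with  [refs: 2505.08710, 2008.02571, 2412.20078, 1908.09512, 2405.00270, paper:arxiv-2505.08710, paper:arxiv-2008.02571, paper:arxiv-2412.20078, paper:arxiv-1908.09512]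

Barriers (technique_class: iwasawa-anticyclotomic, kolyvagin-system, mu-bookkeeping): - technique_class: iwasawa-anticyclotomic, kolyvagin-system, mu-bookkeeping
- Literature.Barriers.BirchSwinnertonDyer.EulerSystemBigImageBarrier: outside — the Kolyvagin-system
step runs at SCALAR image (Mastella–Zerman Cor. 4.6: image ⊇ 1 + pℤ_p scalars, Lombardo–Tronto Thm.
3.16 supplies it on X9), never (sur)/(im); the class-number removal does not touch the image
hypothesis.
- Literature.Barriers.BirchSwinnertonDyer.EisensteinMuBarrier: outside — E[p] is irreducible on X9
(no Eisenstein congruence forces μ > 0); the μ used here is μ(BDP) = 0 (Hsieh/Burungale, irreducible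
case) and the class-group μ of K (Rubin/Gillard), both theorems.
- Literature.Barriers.BirchSwinnertonDyer.CMRankOneAtNonsplitTwo: outside — class X9 is non-CM with
p ≥ 5 good; no CM curve and no pair (E, 2) is in the scope of any item.
- Literature.Barriers.BirchSwinnertonDyer.CMRankOneAtRamifiedPrime: outside — the barrier quantifies
over CM curves at a ramified prime of the CM field; every pair here is non-CM with p of good
ordinary reduction (ClassX9).
- Literature.Barriers.BirchSwinnertonDyer.StringentKolyvaginCapsAtMax: outside — no Tamagawa factor
is extracted from stringent local conditions: the full product ∏ c_ℓ enters through the two-sided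
Λ-adic main conjecture plus JSW Thm. 3.3.1 control (crux TwoSidedLinkAnyClassNumber +
`thm331_anticyclotomicControl`), exactly as on the cell's landed Howard road; crux
HowardContainmentAnyClassNumber is a Λ-adic containment with no Tamagawa content — which i

History (route lifecycle, newest last):
- 2026-08-28T08:46:56Z · CLOSED superseded — superseded:route-BirchSwinnertonDyer-PrintX9 (planner-bsd-idea-2-g5-0)

sub-problem: BirchSwinnertonDyer · status: closed(superseded) · opened planner-bsd-idea-2-g0-0 2026-08-27T22:38:20Z · rev 6 · ledger route-BirchSwinnertonDyer-TorsionLayerDescent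
GENERATED by the gate from the ledger (D-0016/17). Provers cite these decls: `theorem foo : Summit.BirchSwinnertonDyer.BirchSwinnertonDyer.Theses.TorsionLayerDescent.<Decl> := …` in Summits/BirchSwinnertonDyer/BirchSwinnertonDyer/Theorems/<Name>.lean.
-/

namespace Summit.BirchSwinnertonDyer.BirchSwinnertonDyer.Theses.TorsionLayerDescent

open scoped BigOperators Topology Manifold Classical MeasureTheory ProbabilityTheory Matrix InnerProductSpace ComplexConjugate ContinuousMap
open Filter Set Function TopologicalSpace MeasureTheory

attribute [summit_statement] _root_.BirchSwinnertonDyer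
attribute [summit_statement] _root_.Summit.BirchSwinnertonDyer.BirchSwinnertonDyer.Rank1Residual.BSDpOnClassX9

open Literature

/-- item stmt-BirchSwinnertonDyer-23164 · crux (kind.auto-crux: conjecture-grade) · rank 9 · closed · moot by None · by planner
why it might fail: auto-crux — conjecture-grade statement (statement references the registered conjecture Summit.BirchSwinnertonDyer.BirchSwinnertonDyer.Rank1Residual.IntegralMainConjectureOnClassX9); it is open, so it may simply be false
sources: arXiv:2405.00270, Kato2004Asterisque, Greenberg1999
[support] BY NAME — the K6 rank-0 engine on class X9,
`Rank1Residual.IntegralMainConjectureOnClassX9` (the cell's landed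
`integralMainConjectureOnClassX9_of_katoMuTransfer` reduces it to BCS Thm 1.1.1(im-free) +
KatoMuTransfer + AnalyticMuZeroOnClassX9, i.e. to route SmallImageMuTransfer's cruxes); this line
does not touch it. [difficulty: open-problem] -/
@[route_item "route-BirchSwinnertonDyer-TorsionLayerDescent", crux]
def EngineIMCX9 : Prop :=
  Summit.BirchSwinnertonDyer.BirchSwinnertonDyer.Rank1Residual.IntegralMainConjectureOnClassX9

/-- item stmt-BirchSwinnertonDyer-23161 · aside · rank 2 · open · by planner
why it might fail: when K_∞ ∩ H_K ≠ K the tree's norm-point Heegner family generates a proper submodule of the CGLS enlarged module ∪_k H_k[1], so heegnerCharIdeal D F may exceed char(Sel/Λκ₁) by a factor at (p, γ−1) and the containment as typed can fail by it; MZ26 §3 uses p ∤ h_K for K[n] ∩ K_∞ = K.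
sources: arXiv:2505.08710, arXiv:2008.02571, arXiv:1908.09512, Howard2004HeegnerKolyvagin, LombardoTronto2022
[crux] for every X9 pair (E,p) (p ≥ 5 good ordinary, E[p] irreducible with non-surjective image,
non-CM), every imaginary quadratic K with d_K ∉ {−3,−4} satisfying the Heegner hypothesis for N_E
and for p (p split), every anticyclotomic ℤ_p-extension datum (κ, γ) and every modular
parametrisation / Heegner datum, there exist the Λ-adic Selmer data, a Heegner family (in the tree's
sense) and a Selmer dual with heegnerCharIdeal² ≤ char(X_tors) — Howard's Theorem B containment —
with NO hypothesis on the class number of K (the landed `X9.heegnerContainment_of_cor46` is exactly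
this with `¬ p ∣ classNumber K` added, from Mastella–Zerman Cor. 4.6). [difficulty: L] -/
@[route_item "route-BirchSwinnertonDyer-TorsionLayerDescent"]
def HowardContainmentAnyClassNumber : Prop :=
  ∀ (W : WeierstrassCurve ℚ) [W.IsElliptic] [W.IsGloballyMinimal] (p : ℕ) [Fact p.Prime] [NeZero (W.conductorNorm ℤ)] (K : Type) [Field K] [NumberField K], Summit.BirchSwinnertonDyer.BirchSwinnertonDyer.Rank1Residual.ClassX9 W p → Literature.NumberTheory.EllipticCurves.IsImaginaryQuadratic K → NumberField.discr K ≠ -3 → NumberField.discr K ≠ -4 → Literature.NumberTheory.EllipticCurves.SatisfiesHeegnerHypothesis (W.conductorNorm ℤ) K → Literature.NumberTheory.EllipticCurves.SatisfiesHeegnerHypothesis p K → ∀ (κ : Literature.NumberTheory.EllipticCurves.ZpExtension K p), κ.IsAnticyclotomic → ∀ (γ : Field.absoluteGaloisGroup K), κ.IsTopGenerator γ → ∀ (Dt : Literature.NumberTheory.EllipticCurves.ModularForms.ModularParametrizationData W (W.conductorNorm ℤ)) (H : Literature.NumberTheory.EllipticCurves.HeegnerDatum (W.conductorNorm ℤ)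 (NumberField.discr K)) (ιC : K →+* ℂ), ∃ (jbar : AlgebraicClosure K →+* ℂ) (D : (W.baseChange K).LambdaAdicSelmerData κ γ) (F : Literature.NumberTheory.EllipticCurves.HeegnerFamily (W.conductorNorm ℤ) W K κ jbar) (X : (W.baseChange K).SelmerDualData κ γ), Literature.NumberTheory.EllipticCurves.heegnerCharIdeal D F ^ 2 ≤ Literature.NumberTheory.EllipticCurves.Module.charIdeal (Literature.NumberTheory.EllipticCurves.IwasawaAlgebra p) (Submodule.torsion (Literature.NumberTheory.EllipticCurves.IwasawaAlgebra p) X.X)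

/-- item stmt-BirchSwinnertonDyer-23162 · aside · rank 3 · open · by planner
why it might fail: the integral comparison runs through Greenberg's L, 𝓛^Gr = h_K·𝓛_𝔭(K)′·𝓛^II (Yan–Zhu Def. 3.10): for p | h_K it is off by p^v_p(h_K) unless the class-group μ matches integrally, and at (irr) the Beilinson–Flach reciprocity (CGS Lemma 3.11) is only integral, not a unit.
sources: arXiv:2412.20078, arXiv:2405.00270, CastellaGrossiLeeSkinner2022, JetchevSkinnerWan2017, doi:10.4171/dm/466, Rubin1991
[crux] at every rank-one X9 Heegner datum (E, p, K, ι, κ anticyclotomic, γ, Dt with p ∤ c(Dt), H, P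
= the Heegner point, rank E(K) = 1, Ш(E/K)[p^∞] finite, P non-torsion, (irr_K)) over a Heegner field
with p split, d_K odd ≠ −3, GRANTED Howard's containment (the ∃-statement of crux A), the two-sided
IMC∘BDP identity in the JSW/Castella letter `X11b.IMCWaldspurgerOnTreeGoodAt p κ (inducedPlace ι) γ
ι P` holds — with NO hypothesis on h_K (the landed
`X11b.imcWaldspurgerOnTreeGoodAt_inducedPlace_of_heegnerContainment_of_thm331` is this with `¬ p ∣
classNumber K`, from Yan–Zhu 5.7(1)+5.9, BCS Prop. 4.2.2, CGLS Thm. 5.1.3, JSW Thm. 3.3.1). [deps: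
HowardContainmentAnyClassNumber] [difficulty: L] -/
@[route_item "route-BirchSwinnertonDyer-TorsionLayerDescent"]
def TwoSidedLinkAnyClassNumber : Prop :=
  ∀ (W : WeierstrassCurve ℚ) [W.IsElliptic] [W.IsGloballyMinimal] (p : ℕ) [Fact p.Prime] [NeZero (W.conductorNorm ℤ)] (K : Type) [Field K] [NumberField K], Summit.BirchSwinnertonDyer.BirchSwinnertonDyer.Rank1Residual.ClassX9 W p → Literature.NumberTheory.EllipticCurves.IsImaginaryQuadratic K → Odd (NumberField.discr K) → NumberField.discr K ≠ -3 → Literature.NumberTheory.EllipticCurves.SatisfiesHeegnerHypothesis (W.conductorNorm ℤ) K → Literature.NumberTheory.EllipticCurves.SatisfiesHeegnerHypothesis p K → (W.baseChange K).HasIrreducibleModPGaloisRep p → ∀ (ι : K →+* ℚ_[p]) (κ : Literature.NumberTheory.EllipticCurves.ZpExtension K p), κ.IsAnticyclotomic → ∀ (γ : Field.absoluteGaloisGroup K) [Fact (κ.IsTopGenerator γ)] (Dt : Literature.NumberTheory.EllipticCurves.ModularForms.ModularParametrizationData W (W.conductorNorm ℤ)), ¬ (p : ℤ) ∣ Dt.c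 → ∀ (H : Literature.NumberTheory.EllipticCurves.HeegnerDatum (W.conductorNorm ℤ) (NumberField.discr K)) (ιC : K →+* ℂ) (P : (W.baseChange K).toAffine.Point), WeierstrassCurve.Affine.Point.map ιC.toRatAlgHom P = Literature.NumberTheory.EllipticCurves.ModularForms.heegnerPointComplex Dt H → (W.baseChange K).mordellWeilRank = 1 → Finite (AddCommGroup.primaryComponent (W.baseChange K).sha p) → ¬ IsOfFinAddOrder P → (∃ (jbar : AlgebraicClosure K →+* ℂ) (D : (W.baseChange K).LambdaAdicSelmerData κ γ) (F : Literature.NumberTheory.EllipticCurves.HeegnerFamily (W.conductorNorm ℤ) W K κ jbar) (X : (W.baseChange K).SelmerDualData κ γ), Literature.NumberTheory.EllipticCurves.heegnerCharIdeal D F ^ 2 ≤ Literature.NumberTheory.EllipticCurves.Module.charIdeal (Literature.NumberTheory.EllipticCurves.IwasawaAlgebra p) (Submodule.torsion (Literature.NumberTheory.EllipticCurves.IwasawaAlgebra p) X.X)) → Summit.BirchSwinnertonDyer.Rank1Residual.X11b.IMCWaldspurgerOnTreeGoodAt p κ (Summit.BirchSwinnertonDyer.Rank1Residual.X11b.inducedPlace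 ι) γ ι P

/-- item stmt-BirchSwinnertonDyer-19266 · aside · rank 9 · open · by planner
sources: BCDTJAMS2001 Thm A, Summits/BirchSwinnertonDyer/BirchSwinnertonDyer/Theses/PrintX9.lean (ModularParametrizationSupply)
[support] modularity of E/ℚ as parametrisation data (Breuil–Conrad–Diamond–Taylor 2001 Thm A), BY
NAME — conjunct of OrdPublishedInputsAtTwo (19149; Literature.Uncategorized.OrdPublishedInputsAtTwo
l.26); same content, filed so the head constant is item-stated (#15c one rule; cite_only dep) -/
@[route_item "route-BirchSwinnertonDyer-TorsionLayerDescent"]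
def ModularParametrizationSupply : Prop :=
  Literature.NumberTheory.EllipticCurves.ModularForms.nonempty_modularParametrizationData

/-- item stmt-BirchSwinnertonDyer-19273 · aside · rank 9 · open · by planner
sources: BCDTJAMS2001, Summits/BirchSwinnertonDyer/BirchSwinnertonDyer/Theses/PrintX9.lean (EntireLFunctionRat)
[support] entire continuation of L(E/ℚ, s) (modularity: Breuil–Conrad–Diamond–Taylor 2001 Thm A +
Hecke/Shimura), BY NAME — conjunct of MultConversePublishedInputsAtTwo (19185); same content, filed
so the head constant is item-stated (#15c one rule; cite_only dep) -/
@[route_item "route-BirchSwinnertonDyer-TorsionLayerDescent"]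
def EntireLFunctionRat : Prop :=
  WeierstrassCurve.hasEntireLFunction_rat

/-- item stmt-BirchSwinnertonDyer-19290 · aside · rank 9 · closed · proved by Summit.BirchSwinnertonDyer.BirchSwinnertonDyer.Theorems.SignedLowerHalves.RealPeriodUnitPlusPeriod_proof (prover) · by operator
sources: GreenbergVatsal2000 Rem 3.4, AbbesUllmo1996, Summits/BirchSwinnertonDyer/BirchSwinnertonDyer/Theses/PrintX9.lean (RealPeriodUnitPlusPeriod)
[support] Néron period vs. plus period of the newform: Ω_E = u · Ω⁺_f with u a p-adic unit, p ≥ 5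
(Manin constant: Mazur 1978 Cor. 4.1, Edixhoven 1991 Prop. 2, Abbes–Ullmo 1996 Thm. A;
Greenberg–Vatsal 2000 Rem. 3.4) — conjunct of PublishedSignedInputs
(stmt-BirchSwinnertonDyer-19005), BY NAME; same content, filed as a split child so the head constant
is item-stated (gate5 #15c one rule; readiness rule 2026-08-15: cite_only dep declared by the
route); no statement / closes / tribunal change -/
@[route_item "route-BirchSwinnertonDyer-TorsionLayerDescent"]
def RealPeriodUnitPlusPeriod : Prop :=
  Literature.NumberTheory.EllipticCurves.realPeriodRat_eq_unit_mul_plusPeriod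

/-- `RealPeriodUnitPlusPeriod` holds: proved by `Summit.BirchSwinnertonDyer.BirchSwinnertonDyer.Theorems.SignedLowerHalves.RealPeriodUnitPlusPeriod_proof`. -/
theorem RealPeriodUnitPlusPeriod_holds : RealPeriodUnitPlusPeriod := _root_.Summit.BirchSwinnertonDyer.BirchSwinnertonDyer.Theorems.SignedLowerHalves.RealPeriodUnitPlusPeriod_proof

/-- item stmt-BirchSwinnertonDyer-19382 · aside · rank 9 · open · by planner
sources: BCDTJAMS2001, Summits/BirchSwinnertonDyer/BirchSwinnertonDyer/Theses/PrintX9.lean (NewformExistence)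
[support] Modularity Theorem, Version L (Diamond–Shurman 2005 Thm. 8.8.3; Wiles / Taylor–Wiles /
BCDT 2001 Thm. A): every E/ℚ has a weight-2 newform f of level N_E with L(f,s) = L(E,s) — conjunct
of PublishedInputsFive (stmt-BirchSwinnertonDyer-19066), BY NAME; same content, filed as a split
child so the head constant is item-stated (gate5 #15c one rule / readiness rule 2026-08-15: a
cite_only dep must be declared by the route); no crux statement / closes / tribunal / tribunal_fit
change -/
@[route_item "route-BirchSwinnertonDyer-TorsionLayerDescent"]
def NewformExistence : Prop :=
  Literature.NumberTheory.EllipticCurves.ModularForms.exists_isNewformOf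

/-- item stmt-BirchSwinnertonDyer-19383 · aside · rank 9 · closed · proved by Summit.BirchSwinnertonDyer.BirchSwinnertonDyer.Theorems.ManinLocalTwoThree.MazurManinConstantOddPrimes_proof (prover) · by planner
sources: Mazur1978 Cor 4.1, Summits/BirchSwinnertonDyer/BirchSwinnertonDyer/Theses/PrintX9.lean (MazurManinConstantOdd)
[support] Mazur 1978 Cor. 4.1 (with Edixhoven 1991 Prop. 2: c ∈ ℤ): for every odd prime p with p² ∤
N the Manin constant is prime to p — conjunct of PublishedInputsFive
(stmt-BirchSwinnertonDyer-19066), BY NAME; same content, filed as a split child so the head constant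
is item-stated (gate5 #15c one rule / readiness rule 2026-08-15: a cite_only dep must be declared by
the route); no crux statement / closes / tribunal / tribunal_fit change -/
@[route_item "route-BirchSwinnertonDyer-TorsionLayerDescent"]
def MazurManinConstantOdd : Prop :=
  Literature.NumberTheory.EllipticCurves.ModularForms.mazur_not_dvd_maninConstant_of_odd

/-- `MazurManinConstantOdd` holds: proved by `Summit.BirchSwinnertonDyer.BirchSwinnertonDyer.Theorems.ManinLocalTwoThree.MazurManinConstantOddPrimes_proof`. -/
theorem MazurManinConstantOdd_holds : MazurManinConstantOdd := _root_.Summit.BirchSwinnertonDyer.BirchSwinnertonDyer.Theorems.ManinLocalTwoThree.MazurManinConstantOddPrimes_proof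

/-- item stmt-BirchSwinnertonDyer-19460 · aside · rank 9 · closed · proved by Summit.BirchSwinnertonDyer.BirchSwinnertonDyer.Theorems.InputsDeskTwoTurnkey.smallImageMuTransfer_greenbergCharValueRankZero (prover) · by planner
sources: GreenbergLNM1716 Thm 4.1, Summits/BirchSwinnertonDyer/BirchSwinnertonDyer/Theses/PrintX9.lean (GreenbergCharValueRankZero)
[support, cite-only] Greenberg LNM 1716 Thm 4.1 (p. 102; held copy
book:coatesnd-arithmetic-theory-elliptic-curves chunk p0091): the rank-0 Euler-characteristic
formula f_E(0) ~ #Sel · ∏c_v · #Ẽ(𝔽_p)² / #E(ℚ)_tors² at good ordinary p — conjunct of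
PublishedInputsX9 (stmt-BirchSwinnertonDyer-19632, text FROZEN REF v8-3), BY NAME; same content,
filed as a split child so the head constant is item-stated (readiness rule 2026-08-15 / gate5 #15c:
a cite_only dep must be declared by the route); no crux statement / closes / tribunal change; never
staffed for proof (cite-only, to be HELD), closes only when the named fact becomes a theorem -/
@[route_item "route-BirchSwinnertonDyer-TorsionLayerDescent"]
def GreenbergCharValueRankZero : Prop :=
  Literature.NumberTheory.EllipticCurves.greenberg_charValue_rankZero

/-- `GreenbergCharValueRankZero` holds: proved by `Summit.BirchSwinnertonDyer.BirchSwinnertonDyer.Theorems.InputsDeskTwoTurnkey.smallImageMuTransfer_greenbergCharValueRankZero`. -/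
theorem GreenbergCharValueRankZero_holds : GreenbergCharValueRankZero := _root_.Summit.BirchSwinnertonDyer.BirchSwinnertonDyer.Theorems.InputsDeskTwoTurnkey.smallImageMuTransfer_greenbergCharValueRankZero

/-- item stmt-BirchSwinnertonDyer-19921 · aside · rank 9 · open · by operator
sources: GrossZagier1986, KolyvaginEulerSystems1990, Summits/BirchSwinnertonDyer/BirchSwinnertonDyer/Theses/PrintX9.lean (RankEqAnalyticRankLeOne)
[support] The one PUBLISHED input the halves-glue consumes: Gross–Zagier–Kolyvagin, rank = analytic
rank for analytic rank ≤ 1 with Ш finite (tree named fact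
rank_eq_analyticRank_of_analyticRank_le_one; used by bsdp_of_missingPPartAt to turn Miller's last
clause into BSD(E,2)). Carried as a displayed PUB hypothesis; never counted as progress. The further
PRINT of the roads to the two halves (Greenberg Thm-4.1 analogues at a multiplicative prime
thm41Analogue_charValue_rankZero_numberField_anyPrime / …_split_baseChange_anyPrime, modularity) and
the referee-passed MEMO inputs (Kato ⊗ℚ at a multiplicative 2:
X5.O1.KatoMultiplicativeDivisibilityRat W 2, HOME mult/PROOF-MULT.md RC-2; Greenberg–Stevens at 2:
greenberg_stevens W 2, mult/PROOF-GS2.md RC-4) enter the LINES under the halves (bridge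
multiplicativeRankZeroAtTwo_of_muRoad, p409679), not this glue. -/
@[route_item "route-BirchSwinnertonDyer-TorsionLayerDescent"]
def RankEqAnalyticRankLeOne : Prop :=
  Literature.NumberTheory.EllipticCurves.rank_eq_analyticRank_of_analyticRank_le_one

/-- item stmt-BirchSwinnertonDyer-20535 · aside · rank 9 · open · by planner
sources: JetchevSkinnerWan2017 Thm 3.3.1, Summits/BirchSwinnertonDyer/BirchSwinnertonDyer/Theses/PrintX9.lean (JSWAnticyclotomicControl)
[aside, cite-only] Jetchev–Skinner–Wan 2017 Thm 3.3.1 (Camb. J. Math. 5): anticyclotomic control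
theorem (index bound 2·ord_p[E(K):ℤP] ≤ ord_p #Ш(E/K) + 2t from the generator's constant
coefficient) — conjunct 8 of HeegnerPrintFactsX9 — filed so the cite_only head constant is
item-stated BY NAME (gate5 #15c one rule; staffable remedy; K6 precedent
route-BirchSwinnertonDyer-SmallImageMuTransfer); banked context (D-0019 aside): never staffed, not
progress, closes only when the named fact becomes a theorem; no crux statement / closes content
change. -/
@[route_item "route-BirchSwinnertonDyer-TorsionLayerDescent"]
def JSWAnticyclotomicControl : Prop :=
  Literature.NumberTheory.EllipticCurves.JetchevSkinnerWan2017.thm331_anticyclotomicControl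

/-- item stmt-BirchSwinnertonDyer-23163 · support · rank 9 · closed · moot by None · by planner
sources: FriedbergHoffstein1995, JetchevSkinnerWan2017, BumpFriedbergHoffstein1990
[support] PRINT (Friedberg–Hoffstein 1995 Thm. B with prescribed local behaviour at 2, p, ∞ and the
primes of N_E; cf. JSW 2017 §7.4.1): every X9 pair of analytic rank one has an imaginary quadratic K
with d_K odd < −4, Heegner for N_E, p split, and L(E^(d_K),1) ≠ 0 — the cell's hFS with the
class-number conjunct DELETED. The tree fact
`friedbergHoffstein_exists_heegnerField_split_twist_ne_zero` gives everything except `Odd d_K`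
(automatic when 2 | N_E; else one more local condition at 2 in FH). [difficulty: M] -/
@[route_item "route-BirchSwinnertonDyer-TorsionLayerDescent", crux]
def LightFrameSupplyOdd : Prop :=
  ∀ (W : WeierstrassCurve ℚ) [W.IsElliptic] [W.IsGloballyMinimal] [NeZero (W.conductorNorm ℤ)] (p : ℕ) [Fact p.Prime], Summit.BirchSwinnertonDyer.BirchSwinnertonDyer.Rank1Residual.ClassX9 W p → W.analyticRank = 1 → ∃ (K : Type) (_ : Field K) (_ : NumberField K), Literature.NumberTheory.EllipticCurves.IsImaginaryQuadratic K ∧ Odd (NumberField.discr K) ∧ NumberField.discr K < -4 ∧ Literature.NumberTheory.EllipticCurves.SatisfiesHeegnerHypothesis (W.conductorNorm ℤ) K ∧ Literature.NumberTheory.EllipticCurves.SatisfiesHeegnerHypothesis p K ∧ (W.quadraticTwist (NumberField.discr K : ℚ)).entireLFunction 1 ≠ 0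

/-- item stmt-BirchSwinnertonDyer-23165 · support · rank 9 · closed · moot by None · by planner
sources: JetchevSkinnerWan2017, GrossZagier1986, Kolyvagin1990, Greenberg1999, Mazur1978
[support] the conjunction of the PUBLISHED named facts consumed by the per-pair descent and the
index identity: JSW 2017 Thm. 3.3.1 (anticyclotomic control), Gross–Zagier, Kolyvagin, Greenberg's
rank-0 characteristic value, GZK rank = analytic rank ≤ 1, entire L-function over ℚ, existence of
modular parametrisations and of the attached newform, Mazur's Manin-constant theorem (odd part),
integral Néron scaling at a minimal model, real period = unit · plus-period. [difficulty:
provable-now] -/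
@[route_item "route-BirchSwinnertonDyer-TorsionLayerDescent", crux]
def DescentPrintFacts : Prop :=
  Literature.NumberTheory.EllipticCurves.JetchevSkinnerWan2017.thm331_anticyclotomicControl ∧ (∀ (N : ℕ) [NeZero N] (W : WeierstrassCurve ℚ) (K : Type) [Field K] [NumberField K], Literature.NumberTheory.EllipticCurves.gross_zagier N W K) ∧ (∀ (N : ℕ) [NeZero N] (W : WeierstrassCurve ℚ) (K : Type) [Field K] [NumberField K], Literature.NumberTheory.EllipticCurves.kolyvagin N W K) ∧ Literature.NumberTheory.EllipticCurves.greenberg_charValue_rankZero ∧ Literature.NumberTheory.EllipticCurves.rank_eq_analyticRank_of_analyticRank_le_one ∧ WeierstrassCurve.hasEntireLFunction_rat ∧ Literature.NumberTheory.EllipticCurves.ModularForms.nonempty_modularParametrizationData ∧ Literature.NumberTheory.EllipticCurves.ModularForms.exists_isNewformOf ∧ Literature.NumberTheory.EllipticCurves.ModularForms.mazur_not_dvd_maninConstant_of_odd ∧ Literature.NumberTheory.EllipticCurves.integral_neronScaling_of_isGloballyMinimal ∧ Literature.NumberTheory.EllipticCurves.realPeriodRat_eq_unit_mul_plusPeri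od

/-- item stmt-BirchSwinnertonDyer-24876 · support · rank 9 · open · by planner
sources: arXiv:2412.20078 Thm 5.7(1), Thm 5.9, arXiv:2405.00270 Prop 4.2.2, arXiv:2008.02571 Thm 5.1.3, Summits/BirchSwinnertonDyer/BirchSwinnertonDyer/Theses/PrintX9.lean (stmt-24876)
[support, cite-only, by name] the composite named fact Yan–Zhu 2026 Thm 5.7 (1) + Thm 5.9 ∘ BCS 2025
Prop 4.2.2 ∘ CGLS 2022 Thm 5.1.3 GRANTED Howard's containment (tree fact
`YanZhu2026.thm57_thm59_bcs422_cgls513_generator_constantCoeff_of_heegnerDivisibility`, flag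
YZ26-57i+59+BCS422+CGLS513-composite; p ∤ h_K among its printed hypotheses) — the PRINT input of the
p ∤ h_K regime of crux B (landed
`X11b.imcWaldspurgerOnTreeGoodAt_inducedPlace_of_heegnerContainment_of_thm331`, which takes exactly
hYZ + JSW 3.3.1 + the containment). Filed so that `hYZ` is a BINDER of `closes` (same reason as
MastellaZermanHowardDivisibility; it is a conjunct of PrintX10b's HeegnerPrintFactsX10b but NOT of
this route's HeegnerPrintFactsX9). Never staffed. [difficulty: cite-only] -/
@[route_item "route-BirchSwinnertonDyer-TorsionLayerDescent", crux]
def YanZhuTwoSidedComposite : Prop :=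
  Literature.NumberTheory.EllipticCurves.YanZhu2026.thm57_thm59_bcs422_cgls513_generator_constantCoeff_of_heegnerDivisibility

/-- item stmt-BirchSwinnertonDyer-25547 · crux · rank 3 · closed · moot by None · by planner
why it might fail: For p | h_K, Greenberg's 𝓛^Gr = h_K·𝓛_𝔭(K)′·𝓛^II (Yan–Zhu Def 3.10) is off by p^(v_p h_K) unless the class-group μ matches integrally, and at (irr) the Beilinson–Flach reciprocity (CGS Lemma 3.11) is integral, not a unit; the YZ composite prints p ∤ h_K only.
sources: arXiv:2412.20078 Thm 5.7(1), Thm 5.9, Def 3.10, arXiv:2405.00270 Prop 4.2.2, arXiv:2008.02571 Thm 5.1.3, JetchevSkinnerWan2017 Thm 3.3.1, Summits/BirchSwinnertonDyer/BirchSwinnertonDyer/Theorems/PrintX9HowardIMCLink.lean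
[crux] crux B (the two-sided IMC∘BDP identity `X11b.IMCWaldspurgerOnTreeGoodAt` at every rank-one X9
Heegner datum with p split, d_K odd ≠ −3, no class-number hypothesis, = stmt-23162 verbatim) GRANTED
by name the Yan–Zhu∘BCS∘CGLS composite fact and the route's DescentPrintFacts (JSW Thm 3.3.1 is its
first conjunct): the p ∤ h_K regime is then the landed
`X11b.imcWaldspurgerOnTreeGoodAt_inducedPlace_of_heegnerContainment_of_thm331`; content left = the p
| h_K regime (Greenberg's 𝓛^Gr = h_K·𝓛_𝔭(K)′·𝓛^II bookkeeping made integral). 23162 ⇒ this item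
trivially. -/
@[route_item "route-BirchSwinnertonDyer-TorsionLayerDescent", crux]
def TwoSidedLinkAnyClassNumberOfPrint : Prop :=
  YanZhuTwoSidedComposite → DescentPrintFacts → TwoSidedLinkAnyClassNumber

/-- item stmt-BirchSwinnertonDyer-25233 · support · rank 9 · open · by planner
sources: arXiv:2505.08710 Cor 4.6, Summits/BirchSwinnertonDyer/BirchSwinnertonDyer/Theses/PrintX9.lean (stmt-25233, rev 18)
[support, cite-only, by name] Mastella–Zerman 2026 Cor. 4.6 (arXiv:2505.08710) = Howard's Thm B
divisibility char_Λ(X_tors) ∣ I(ℋ_∞)² (with 𝐒 torsion-free of rank one, X of rank one) under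
`MastellaZerman2026.Hypotheses` (E[p] irreducible + scalar in the image, p ∤ h_K·disc, Heegner,
anticyclotomic): the VERBATIM BODY of the tree named fact
`MastellaZerman2026.cor46_howardDivisibility_of_scalarImage` at universe 0 (K : Type) —
definitionally equal to `cor46_howardDivisibility_of_scalarImage.{0}` (the fact is
universe-polymorphic, so the item states its body, not the constant; rev 18). The PRINT input of the
p ∤ h_K regime of the deciding crux HowardContainmentLightFrameOfPrint (X9 discharge
`X9.heegnerContainment_of_cor46`, the route's BC5 witness; line stub s1 proved from it, p596622).
Filed so that `h46` is a BINDER of `closes`. Never staffed; closes only if the fact becomes a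
theorem (then `fun … => cor46_holds.{0} …`). -/
@[route_item "route-BirchSwinnertonDyer-TorsionLayerDescent", crux]
def MastellaZermanHowardDivisibility : Prop :=
  ∀ (N : ℕ) [NeZero N] (W : WeierstrassCurve ℚ) [W.IsGloballyMinimal] (K : Type) [Field K] [NumberField K] (p : ℕ) [Fact p.Prime] (κ : Literature.NumberTheory.EllipticCurves.ZpExtension K p) (γ : Field.absoluteGaloisGroup K) (jbar : AlgebraicClosure K →+* ℂ), Literature.NumberTheory.EllipticCurves.MastellaZerman2026.Hypotheses N W K p κ γ → ∀ (D : (W.baseChange K).LambdaAdicSelmerData κ γ) (F : Literature.NumberTheory.EllipticCurves.HeegnerFamily N W K κ jbar) (X : (W.baseChange K).SelmerDualData κ γ), (Module.Finite (Literature.NumberTheory.EllipticCurves.IwasawaAlgebra p) D.S ∧ NoZeroSMulDivisors (Literature.NumberTheory.EllipticCurves.IwasawaAlgebra p) D.S ∧ Module.finrank (Literature.NumberTheory.EllipticCurves.IwasawaAlgebra p) D.S = 1) ∧ (Module.Finite (Literature.NumberTheory.EllipticCurves.IwasawaAlgebra p) X.X ∧ Module.finrank (Literature.NumberTheory.EllipticCurves.IwasawaAlgebra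 p) X.X = 1 ∧ Literature.NumberTheory.EllipticCurves.Module.charIdeal (Literature.NumberTheory.EllipticCurves.IwasawaAlgebra p) (Submodule.torsion (Literature.NumberTheory.EllipticCurves.IwasawaAlgebra p) X.X) ∣ Literature.NumberTheory.EllipticCurves.heegnerCharIdeal D F ^ 2)

/-- item stmt-BirchSwinnertonDyer-25234 · support · rank 9 · open · by planner
sources: arXiv:2008.02571 Thm 4.1.3, Summits/BirchSwinnertonDyer/BirchSwinnertonDyer/Theses/PrintX9.lean (stmt-25234, rev 18)
[support, cite-only, by name] Castella–Grossi–Lee–Skinner, Invent. Math. 227 (2022) Thm. 4.1.3 (+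
Cor. 3.4.2, Rem. 4.1.4; arXiv:2008.02571): char_Λ(X_tors) = J², J ∣ p^m·T^n·I(Λκ_∞), and at Selmer
corank one J ∣ p^{m'}·I(Λκ_∞) — Howard's divisibility LOCALIZED at p, for ANY class number of K, no
image hypothesis beyond E(K)[p] = 0 (`CastellaGrossiLeeSkinner2022.Thm413Hypotheses`,
`StabilizedHeegnerData`, `stabilizedHeegnerCharIdeal`; typed by the cell lit seat g19, p596552): the
VERBATIM BODY of the tree named fact
`CastellaGrossiLeeSkinner2022.thm413_rankOne_charIdeal_torsion_dvd_localized` at universe 0 (K :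
Type) — definitionally `thm413_rankOne_charIdeal_torsion_dvd_localized.{0}` (universe-polymorphic
fact; rev 18). The PRINT input of the δ > 0 localized regime of the deciding crux (line stub
`stub_depthPos_localized`; consumers `span_pow_mul_sq_le_charIdeal_torsion_of_thm413`). Filed so
that `hCGLS` is a BINDER of `closes`. Never staffed. -/
@[route_item "route-BirchSwinnertonDyer-TorsionLayerDescent", crux]
def CGLSHowardDivisibilityLocalized : Prop :=
  ∀ (N : ℕ) [NeZero N] (W : WeierstrassCurve ℚ) [W.IsGloballyMinimal] (K : Type) [Field K] [NumberField K] (p : ℕ) [Fact p.Prime] (κ : Literature.NumberTheory.EllipticCurves.ZpExtension K p) (γ : Field.absoluteGaloisGroup K) (jbar : AlgebraicClosure K →+* ℂ), Literature.NumberTheory.EllipticCurves.CastellaGrossiLeeSkinner2022.Thm413Hypotheses N W K p κ γ → ∀ (D : (W.baseChange K).LambdaAdicSelmerData κ γ) (C : Literature.NumberTheory.EllipticCurves.CastellaGrossiLeeSkinner2022.StabilizedHeegnerData N W K κ jbar) (X : (W.baseChange K).SelmerDualData κ γ), (Module.Finite (Literature.NumberTheory.EllipticCurves.IwasawaAlgebra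 p) D.S ∧ Module.finrank (Literature.NumberTheory.EllipticCurves.IwasawaAlgebra p) D.S = 1) ∧ (Module.Finite (Literature.NumberTheory.EllipticCurves.IwasawaAlgebra p) X.X ∧ Module.finrank (Literature.NumberTheory.EllipticCurves.IwasawaAlgebra p) X.X = 1 ∧ ∃ (J : Ideal (Literature.NumberTheory.EllipticCurves.IwasawaAlgebra p)) (m n : ℕ), Literature.NumberTheory.EllipticCurves.Module.charIdeal (Literature.NumberTheory.EllipticCurves.IwasawaAlgebra p) (Submodule.torsion (Literature.NumberTheory.EllipticCurves.IwasawaAlgebra p) X.X) = J ^ 2 ∧ J ∣ Ideal.span {((p : Literature.NumberTheory.EllipticCurves.IwasawaAlgebra p) ^ m)} * Ideal.span {((PowerSeries.X : Literature.NumberTheory.EllipticCurves.IwasawaAlgebra p) ^ n)} * Literature.NumberTheory.EllipticCurves.CastellaGrossiLeeSkinner2022.stabilizedHeegnerCharIdeal D C ∧ ((W.baseChange K).selmerCorank p = 1 → ∃ m' : ℕ, J ∣ Ideal.span {((p : Literature.NumberTheory.EllipticCurves.IwasawaAlgebra p) ^ m')} * Literature.NumberTheory.EllipticCurves.CastellaGrossiLeeSkinner2022.stabilizedHeegnerCharIdeal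 D C))

/-- item stmt-BirchSwinnertonDyer-25236 · support · rank 9 · closed · proved by Summit.BirchSwinnertonDyer.BirchSwinnertonDyer.Theorems.PrintX9AnticyclotomicTowerInRingClassFields.anticyclotomicTowerInRingClassFields_holds_X10b (prover) · by planner
sources: arXiv:2008.02571 p.22, PerrinRiou1987, Summits/BirchSwinnertonDyer/BirchSwinnertonDyer/Theses/PrintX9.lean (stmt-25236)
[support, cite-only, classical CFT/CM] For K imaginary quadratic, p odd and κ the anticyclotomic
ℤ_p-extension, EVERY layer K_k lies in SOME ring class field of p-power conductor:
`ringClassSubgroup K (p^d) jbar ≤ κ.layerSubgroup k` for some d (K_∞^ac ⊂ K[p^∞] = ∪_d K[p^d];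
Gal(K[p^∞]/K) ≅ (finite) × ℤ_p and its ℤ_p-quotient is the unique anticyclotomic ℤ_p-extension).
This is exactly what CGLS 2022 §4.1 uses to define the shift d(k) = min{d : K_k ⊂ K[p^d]}
(arXiv:2008.02571 p.22, proof of Thm 4.1.1) and what a
`CastellaGrossiLeeSkinner2022.StabilizedHeegnerData` term needs (fields layer_le/d_min via Nat.find;
the torsion depth δ is then KERNEL-derivable from the proved `finiteIndex_ringClassSubgroup` +
`ZpExtension.index_layerSubgroup`). Not a tree theorem and not a conjunct of
HeegnerPrintFactsX9/CyclotomicPrintFactsX9, hence filed so that `hTw` is a BINDER of `closes` (same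
reason as MastellaZermanHowardDivisibility): without it the δ > 0 localized regime of the deciding
crux (line stub s3) cannot close BY NAME modulo print. Stated over the tree's concrete
`ringClassSubgroup` (singular moduli of reduced forms) — no Literature named fact exists yet (lit
may type one; this item th -/
@[route_item "route-BirchSwinnertonDyer-TorsionLayerDescent", crux]
def AnticyclotomicTowerInRingClassFields : Prop :=
  ∀ (K : Type) [Field K] [NumberField K] (p : ℕ) [Fact p.Prime], Odd p → Literature.NumberTheory.EllipticCurves.IsImaginaryQuadratic K → ∀ (κ : Literature.NumberTheory.EllipticCurves.ZpExtension K p), κ.IsAnticyclotomic → ∀ (jbar : AlgebraicClosure K →+* ℂ) (k : ℕ), ∃ d : ℕ, Literature.NumberTheory.EllipticCurves.ringClassSubgroup K (p ^ d) jbar ≤ κ.layerSubgroup k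

/-- `AnticyclotomicTowerInRingClassFields` holds: proved by `Summit.BirchSwinnertonDyer.BirchSwinnertonDyer.Theorems.PrintX9AnticyclotomicTowerInRingClassFields.anticyclotomicTowerInRingClassFields_holds_X10b`. -/
theorem AnticyclotomicTowerInRingClassFields_holds : AnticyclotomicTowerInRingClassFields := _root_.Summit.BirchSwinnertonDyer.BirchSwinnertonDyer.Theorems.PrintX9AnticyclotomicTowerInRingClassFields.anticyclotomicTowerInRingClassFields_holds_X10b

/-- item stmt-BirchSwinnertonDyer-25546 · crux · rank 2 · closed · moot by None · by planner
why it might fail: At p | h_K (K_∞ ∩ H_K ≠ K) the norm-point Heegner family generates a proper submodule of CGLS's enlarged module, so the containment can fail by a factor at (p, γ−1); print gives only MZ26 4.6 (p ∤ h_K) and CGLS 4.1.3 (stabilized, shifted by p^m) — the integral promotion is beyond print.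
sources: arXiv:2505.08710 Cor 4.6, arXiv:2008.02571 Thm 4.1.3, p.22, Howard2004HeegnerKolyvagin Thm B, arXiv:1908.09512, pub/bsd-print-x9/plan/skeletons/23161-torsion-depth, pub/ideators/bsd-idea-2/INBOX.md 2026-08-28T03:29:13Z (bsd-print-x9 plan g8 courtesy: by-name entry defect)
[crux, deciding] crux A (Howard's Theorem B containment heegnerCharIdeal² ≤ char(X_tors) at EVERY X9
Heegner datum with no class-number hypothesis, = stmt-23161 verbatim) GRANTED by name the three
printed inputs: Mastella–Zerman Cor 4.6 (the p ∤ h_K regime, discharged in the tree by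
`X9.heegnerContainment_of_cor46`), CGLS Thm 4.1.3 (localized/stabilized divisibility at any class
number) and the tower-in-ring-class-fields fact. Content left to prove = the p | h_K regime: port
the δ = 0 Howard argument and promote CGLS's stabilized divisibility p^m·I(ℋ)² ⊆ char X_tors
integrally to I(ℋ_F)² (torsion depth). 23161 ⇒ this item trivially (fun _ _ _ => h), so every line
registered on 23161 transports. -/
@[route_item "route-BirchSwinnertonDyer-TorsionLayerDescent", crux]
def HowardContainmentAnyClassNumberOfPrint : Prop :=
  MastellaZermanHowardDivisibility → CGLSHowardDivisibilityLocalized → AnticyclotomicTowerInRingClassFields → HowardContainmentAnyClassNumber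

/-- item stmt-BirchSwinnertonDyer-23166 · assembly · rank 1 · closed · proved by Summit.BirchSwinnertonDyer.BirchSwinnertonDyer.Rank1Residual.TorsionLayer.torsionLayerDescent_assembly (planner) · by planner
sources: arXiv:2505.08710, JetchevSkinnerWan2017
[assembly] HowardContainmentAnyClassNumber → TwoSidedLinkAnyClassNumber → LightFrameSupplyOdd →
EngineIMCX9 → DescentPrintFacts → the K6 leaf BSDpOnClassX9. -/
@[route_item "route-BirchSwinnertonDyer-TorsionLayerDescent", crux]
def Assembly : Prop :=
  HowardContainmentAnyClassNumber → TwoSidedLinkAnyClassNumber → LightFrameSupplyOdd → EngineIMCX9 → DescentPrintFacts → Summit.BirchSwinnertonDyer.BirchSwinnertonDyer.Rank1Residual.BSDpOnClassX9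

-- `Assembly` holds: proved by `Summit.BirchSwinnertonDyer.BirchSwinnertonDyer.Rank1Residual.TorsionLayer.torsionLayerDescent_assembly` (its module imports this route file, so no `_holds` link can be stated here).

/-! D-0027 §2.1 — DECIDING THEOREM (planner-authored via `route open/edit --closes-file`; by planner-bsd-idea-2-g3-0 2026-08-28T03:56:49Z) — ARCHIVED: route closed (superseded) 2026-08-28T08:46:55Z; kept so importers keep building:
its hypotheses are this route's items and its conclusion the registered leaf `Summit.BirchSwinnertonDyer.BirchSwinnertonDyer.Rank1Residual.BSDpOnClassX9` (rung K6, D-0061) (glue_lint), and it elaborates with this file. -/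

@[closes "route-BirchSwinnertonDyer-TorsionLayerDescent"] theorem closes (hAsm : Assembly) (hAP : HowardContainmentAnyClassNumberOfPrint)
    (hBP : TwoSidedLinkAnyClassNumberOfPrint) (hMZ : MastellaZermanHowardDivisibility)
    (hCGLS : CGLSHowardDivisibilityLocalized) (hTw : AnticyclotomicTowerInRingClassFields)
    (hYZ : YanZhuTwoSidedComposite) (hF : LightFrameSupplyOdd) (hE : EngineIMCX9)
    (hD : DescentPrintFacts) :
    Summit.BirchSwinnertonDyer.BirchSwinnertonDyer.Rank1Residual.BSDpOnClassX9 :=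
  hAsm (hAP hMZ hCGLS hTw) (hBP hYZ hD) hF hE hD

end Summit.BirchSwinnertonDyer.BirchSwinnertonDyer.Theses.TorsionLayerDescent
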